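/-
Copyright: rh-split cell (screw, prover seat l19) gen 3, 2026-08-27.  Splitting search over kernel-typed
RH-equivalences.  A splitting `A ∧ B ⟹ RH` is CONDITIONAL bookkeeping unless `A` and `B` are both
proved; nothing here bears on the truth of RH.
-/
import Summits.RiemannHypothesis.RiemannHypothesis.Theses.ScrewMultisection
import Summits.RiemannHypothesis.RiemannHypothesis.Theorems.Splittings.ScrewLatticeMultisection
import HarnessLib

/-!
# Route X-17 `ScrewMultisection` — the crux `MultisectionBridge` BY NAME

`Theses.ScrewMultisection.MultisectionBridge` (item `stmt-RiemannHypothesis-23144`, RH-free): for every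
step `h > 0` and period `q ≥ 1`, an eventually `q`-periodic sign pattern of `Ψ = zetaScrew` on `hℕ`
together with `q` wall-free rays `t e^{2πi j/q}` (`t ∈ [0,1)`) gives `LatticeCeiling h`.
The proof is `ScrewLatticeMultisection.multisectionBridge` (root-of-unity multisection of the Borel
continuation + Vivanti–Pringsheim per eventually one-signed residue class); this file only restates
it with the route's declaration as its literal type.

RH is not proved by this: `MultisectionBridge` is the RH-free leg of the CONDITIONAL splitting X-17
`MultisectionBridge ∧ PeriodicSignsRaysFree ∧ ThinWallOne ⟹ RH`, whose conjuncts
`PeriodicSignsRaysFree` and `ThinWallOne` are open (RH-implied).  No `sorry`, no new axioms.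
-/

set_option linter.dupNamespace false

namespace Summit.RiemannHypothesis.RiemannHypothesis.Theorems.Splittings.ScrewLatticeMultisection

/-- **Item `stmt-RiemannHypothesis-23144` (`MultisectionBridge`), proved by name.** -/
theorem multisectionBridge_proof :
    Summit.RiemannHypothesis.RiemannHypothesis.Theses.ScrewMultisection.MultisectionBridge := by
  unfold Summit.RiemannHypothesis.RiemannHypothesis.Theses.ScrewMultisection.MultisectionBridge
  exact multisectionBridge

end Summit.RiemannHypothesis.RiemannHypothesis.Theorems.Splittings.ScrewLatticeMultisection
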